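import Literature.MathematicalPhysics.QuantumFieldTheory.Balaban1983to89.B9BackgroundsKLevelV1Pb
import Literature.MathematicalPhysics.QuantumFieldTheory.Balaban1983to89.B9SectBGpLettersY

/-!
# `Balaban1983to89.B9SectBCodedClassR` — THE CLASS PARAMETER OF THE SECT.-B CODED-CARRIER CHAIN: a member carrier `bg9YC 𝔸 G P x` over MODULE 3-R's
# class-parametric `bg9YR` whose (3.35)∕(3.36) fields have the SHAPE `(«U is G-valued» ∧ P₁) ∧ P₂` of MODULE 3's two-pin reading, with the two cube conditions
# `P₁ ∕ P₂` (and `Q₁ ∕ Q₂` for (3.36)) a PARAMETER `P : RegExtraY`; MODULE 3's reading and the record's reading `regYPb335 ∕ regYPb336` as instances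

T. Bałaban, *Propagators for lattice gauge theories in a background field*, Commun. Math. Phys. **99** (1985) 389–434 [`Balaban1985BackgroundPropagators`, "B9"],
(3.35)–(3.38) p. 396.

statement-level skeleton of published theorems with citation tags; proofs where landed; nothing here is a claim about the
Yang–Mills mass gap

WHY THIS FILE (cell `pub-ymgap`, Track A node N06 [B9]; director-ym №277 (3) «re-key `hunitA` to the class» + dag-n06-d g17 SOCKET-(α) CLASS QUESTION l.46481;
dag-lead CASCADE-R; seat `pub-ymgap-dag-n06-c` g16).  The 49-file coded-carrier chain of Sect. B (`codingYx` … `sectBStepU_of_members`) is typed over MODULE 3's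
member carrier `bg9Y 𝔸 G x`, i.e. over MODULE 2's small-cube class; two of its displayed laws (`hreg335P`: (3.35) on every plaquette; the class-keyed `hunitA` of №277)
are theorems only over PRINT's class.  The chain's proofs read the class hypothesis `hU : (bg9Y 𝔸 G x).Reg335 c α₀ U` at exactly one kind of site: `hU.1.1 : ∀ μ y,
U μ y ∈ G` (22 sites).  This file types the member carrier over a class PARAMETER that keeps that shape LITERALLY — `(bg9YC 𝔸 G P x).Reg335 c α₀ U` UNFOLDS to
`(GVal G x.toKIdx U ∧ P.P₁ x c α₀ U) ∧ P.P₂ x c α₀ U` — so that the class-parametric twins `…R` of the 49 files are their originals VERBATIM with `bg9Y 𝔸 G ↦ bg9YC 𝔸 G P`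
and ONE extra first argument `P` on every class-dependent name, no proof line touched.  `bg9YC 𝔸 G P = bg9YR 𝔸 G (regC335 𝔸 G P) (regC336 𝔸 G P)` (`rfl`), so MODULE
3-R ∕ 5-R (`kernelFamilyR`, `B9LeafXClassAntitone`) read the twins' outputs with `R₁ := regC335 𝔸 G P`.  Instances: `extraY 𝔸 G` (MODULE 3's reading: `bg9Y 𝔸 G x =
bg9YC 𝔸 G (extraY 𝔸 G) x`, `rfl`) and `extraYPb 𝔸 G` (the record's constant-blind reading of print's class: `regC335 𝔸 G (extraYPb 𝔸 G)` and `regYPb335 𝔸 G` contain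
each other at every threshold, `classIncl_regC335Pb_regYPb335 ∕ classIncl_regYPb335_regC335Pb`, likewise (3.36)).

HONEST SCOPE.  Definitions and `rfl` ∕ one-line bookkeeping; the class is a PARAMETER; no estimate; nothing of [B9] asserted; COUNT-NEUTRAL; N06 NOT discharged;
one finite lattice programme — nothing continuum ∕ OS ∕ mass gap ∕ Clay.  No `sorry`, no `axiom`, no `instance`, no `notation`.
-/

noncomputable section

namespace Literature.MathematicalPhysics.QuantumFieldTheory.Balaban1983to89.B9SectBCodedClassR

open B6GlobalChartV1 (PV)
open B9BackgroundsKLevelV1 (CfgV1 bg9K)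
open B9BackgroundsKLevelV1P (bg9KP bg9YP)
open B9PinMembersKLevelV1 (MemberY geo9Y bg9Y)
open B9BackgroundsKLevelV1R (RegFamY bg9YR regY335 regY336 regYP335 regYP336 MemOfFam Imp336335)
open B9BackgroundsKLevelV1Pb (regYPb335 regYPb336)
open B9PinGeometryKLevelV1 (c35Y)
open B9LeafXClassAntitone (ClassIncl)
open B9SectBGpLettersY (GVal)
open Node00 (CfgY)

variable {d ℓ : ℕ} {hd : 1 ≤ d + 1} {hL : Odd (ℓ + 1) ∧ 1 < ℓ + 1} {b₀ b₁ : ℝ} {Mstar : ℕ}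

/-- **THE CLASS PARAMETER**: the two cube conditions of (3.35) (at the member's index and at its second pin, `P₁`, `P₂`) and of (3.36) (`Q₁`, `Q₂`), as predicate
families on the members' configurations; the «`U` is `G`-valued» conjunct is NOT part of the parameter (the carrier adds it in front, `regC335`).
[cite: Balaban1985BackgroundPropagators, (3.35)–(3.36) p.396 (the cube class 𝒞ⱼ as a parameter)] -/
structure RegExtraY (d ℓ : ℕ) (hd : 1 ≤ d + 1) (hL : Odd (ℓ + 1) ∧ 1 < ℓ + 1) (b₀ b₁ : ℝ) (Mstar : ℕ) (𝔸 : Type) [NormedRing 𝔸] where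
  P₁ : RegFamY d ℓ hd hL b₀ b₁ Mstar 𝔸
  P₂ : RegFamY d ℓ hd hL b₀ b₁ Mstar 𝔸
  Q₁ : RegFamY d ℓ hd hL b₀ b₁ Mstar 𝔸
  Q₂ : RegFamY d ℓ hd hL b₀ b₁ Mstar 𝔸

variable (𝔸 : Type) [NormedRing 𝔸] [NormedAlgebra ℂ 𝔸] [CompleteSpace 𝔸] (G : Subgroup 𝔸ˣ)

/-- **(3.35) OF THE PARAMETRIC CARRIER**, in MODULE 3's two-pin SHAPE: `(«U is G-valued» ∧ P₁) ∧ P₂`. [cite: Balaban1985BackgroundPropagators, (3.35) p.396] -/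
def regC335 (P : RegExtraY d ℓ hd hL b₀ b₁ Mstar 𝔸) : RegFamY d ℓ hd hL b₀ b₁ Mstar 𝔸 :=
  fun x c α₀ U => (GVal G x.toKIdx U ∧ P.P₁ x c α₀ U) ∧ P.P₂ x c α₀ U

/-- **(3.36) OF THE PARAMETRIC CARRIER**, same shape: `(«U is G-valued» ∧ Q₁) ∧ Q₂`. [cite: Balaban1985BackgroundPropagators, (3.36) p.396] -/
def regC336 (P : RegExtraY d ℓ hd hL b₀ b₁ Mstar 𝔸) : RegFamY d ℓ hd hL b₀ b₁ Mstar 𝔸 :=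
  fun x c α₀ U => (GVal G x.toKIdx U ∧ P.Q₁ x c α₀ U) ∧ P.Q₂ x c α₀ U

/-- ★ **THE CLASS-PARAMETRIC MEMBER CARRIER OF THE CODED CHAIN**: MODULE 3-R's `bg9YR` at the families `regC335 ∕ regC336` of the parameter `P`.
[cite: Balaban1985BackgroundPropagators, (3.35)–(3.38) p.396] -/
def bg9YC (P : RegExtraY d ℓ hd hL b₀ b₁ Mstar 𝔸) (x : MemberY d ℓ hd hL b₀ b₁ Mstar) : B9.Backgrounds :=
  bg9YR 𝔸 G (regC335 𝔸 G P) (regC336 𝔸 G P) x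

variable {𝔸 G}
variable (P : RegExtraY d ℓ hd hL b₀ b₁ Mstar 𝔸) (x : MemberY d ℓ hd hL b₀ b₁ Mstar)

/-- the parametric carrier IS MODULE 3-R's at the parametric families (definitional). [cite: Balaban1985BackgroundPropagators, (3.35)–(3.38) p.396 (bookkeeping)] -/
theorem bg9YC_eq_bg9YR : bg9YC 𝔸 G P x = bg9YR 𝔸 G (regC335 𝔸 G P) (regC336 𝔸 G P) x := rfl

/-- same configurations as MODULE 3's carrier (so every letter ∕ kernel ∕ reading of the chain is untouched). [cite: Balaban1985BackgroundPropagators, p.396 (bookkeeping)] -/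
theorem bg9YC_Cfg_eq : (bg9YC 𝔸 G P x).Cfg = (bg9Y 𝔸 G x).Cfg := rfl

/-- same `1`. [cite: Balaban1985BackgroundPropagators, p.396 (bookkeeping)] -/
theorem bg9YC_one_eq : (bg9YC 𝔸 G P x).one = (bg9Y 𝔸 G x).one := rfl

/-- same product. [cite: Balaban1985BackgroundPropagators, p.396 (bookkeeping)] -/
theorem bg9YC_mul_eq : (bg9YC 𝔸 G P x).mul = (bg9Y 𝔸 G x).mul := rfl

/-- same (3.37). [cite: Balaban1985BackgroundPropagators, (3.37) p.396 (bookkeeping)] -/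
theorem bg9YC_cplx337_iff (c : ℝ) (U V : (bg9YC 𝔸 G P x).Cfg) : (bg9YC 𝔸 G P x).Cplx337 c U V ↔ (bg9Y 𝔸 G x).Cplx337 c U V := Iff.rfl

/-- same (3.38). [cite: Balaban1985BackgroundPropagators, (3.38) p.396 (bookkeeping)] -/
theorem bg9YC_cplx338_iff (c : ℝ) (U V : (bg9YC 𝔸 G P x).Cfg) : (bg9YC 𝔸 G P x).Cplx338 c U V ↔ (bg9Y 𝔸 G x).Cplx338 c U V := Iff.rfl

/-- (3.35) of the parametric carrier, unfolded. [cite: Balaban1985BackgroundPropagators, (3.35) p.396 (bookkeeping)] -/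
theorem reg335C_iff (c α₀ : ℝ) (U : (bg9YC 𝔸 G P x).Cfg) :
    (bg9YC 𝔸 G P x).Reg335 c α₀ U ↔ (GVal G x.toKIdx U ∧ P.P₁ x c α₀ U) ∧ P.P₂ x c α₀ U := Iff.rfl

/-- (3.36) of the parametric carrier, unfolded. [cite: Balaban1985BackgroundPropagators, (3.36) p.396 (bookkeeping)] -/
theorem reg336C_iff (c α₀ : ℝ) (U : (bg9YC 𝔸 G P x).Cfg) :
    (bg9YC 𝔸 G P x).Reg336 c α₀ U ↔ (GVal G x.toKIdx U ∧ P.Q₁ x c α₀ U) ∧ P.Q₂ x c α₀ U := Iff.rfl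

/-- what the chain reads: a (3.35)-regular configuration of the parametric carrier is `G`-valued (`hU.1.1`). [cite: Balaban1985BackgroundPropagators, (3.35) p.396 («U with values in G»)] -/
theorem gVal_of_reg335C {c α₀ : ℝ} {U : (bg9YC 𝔸 G P x).Cfg} (hU : (bg9YC 𝔸 G P x).Reg335 c α₀ U) : GVal G x.toKIdx U := hU.1.1

/-- MODULE 3-R's class axiom «`G`-valued» holds for the parametric (3.35) family. [cite: Balaban1985BackgroundPropagators, (3.35) p.396 (bookkeeping)] -/
theorem memOfFam_regC335 : MemOfFam G (regC335 (d := d) (ℓ := ℓ) (hd := hd) (hL := hL) (b₀ := b₀) (b₁ := b₁) (Mstar := Mstar) 𝔸 G P) :=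
  fun _ _ _ _ h => h.1.1

/-- … and for the parametric (3.36) family. [cite: Balaban1985BackgroundPropagators, (3.36) p.396 (bookkeeping)] -/
theorem memOfFam_regC336 : MemOfFam G (regC336 (d := d) (ℓ := ℓ) (hd := hd) (hL := hL) (b₀ := b₀) (b₁ := b₁) (Mstar := Mstar) 𝔸 G P) :=
  fun _ _ _ _ h => h.1.1

/-! ## The two instances: MODULE 3's reading (definitionally `bg9Y`) and the record's reading of print's class -/

variable (𝔸 G)

/-- **MODULE 3's READING AS A PARAMETER**: `P₁ ∕ Q₁` = MODULE 2's small-cube conditions (3.35) ∕ (3.36) at the member's index (the bodies of `bg9K`'s fields after the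
«`G`-valued» conjunct), `P₂ ∕ Q₂` = MODULE 2's whole fields at the second pin. [cite: Balaban1985BackgroundPropagators, (3.35)–(3.36) p.396 (bookkeeping: MODULE 3's reading)] -/
def extraY : RegExtraY d ℓ hd hL b₀ b₁ Mstar 𝔸 where
  P₁ := fun x c α₀ U => B9Eq335RegularityClasses.Reg335 (B9BackgroundsKLevelV1.shiftsV1 _) U (B6KLevelCensusIndexV1.kGeo x.toKIdx).eta
    (B6KLevelCensusIndexV1.kGeo x.toKIdx).L (B9BackgroundsKLevelV1.cubeClass396 x.toKIdx) (c * (B6KLevelCensusIndexV1.kGeo x.toKIdx).M * α₀)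
  P₂ := fun x c α₀ U => (bg9K 𝔸 G x.snd).Reg335 c α₀ U
  Q₁ := fun x c α₀ U => B9Eq335RegularityClasses.Reg336 (B9BackgroundsKLevelV1.shiftsV1 _) U (B6KLevelCensusIndexV1.kGeo x.toKIdx).eta
    (B6KLevelCensusIndexV1.kGeo x.toKIdx).L (B9BackgroundsKLevelV1.cubeClass396 x.toKIdx) (c * (B6KLevelCensusIndexV1.kGeo x.toKIdx).M * α₀)
  Q₂ := fun x c α₀ U => (bg9K 𝔸 G x.snd).Reg336 c α₀ U

/-- ★ MODULE 3's member carrier IS the parametric carrier at MODULE 3's reading — DEFINITIONALLY; so every theorem of the class-parametric chain specialises by `rfl` to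
its original over `bg9Y`. [cite: Balaban1985BackgroundPropagators, (3.35)–(3.38) p.396 (bookkeeping)] -/
theorem bg9Y_eq_bg9YC (x : MemberY d ℓ hd hL b₀ b₁ Mstar) : bg9Y 𝔸 G x = bg9YC 𝔸 G (extraY 𝔸 G) x := rfl

/-- **THE RECORD's READING OF PRINT's CLASS AS A PARAMETER** (constant-blind, with the sign of `α₀`, as `B9BackgroundsKLevelV1Pb.regYPb335 ∕ regYPb336`): `P₁` = `0 ≤ α₀` and
print's cube condition (3.35) at «O(1) = 10» (`c35Y`) at the member's index, `P₂` = MODULE 2-P's whole field at the second pin; likewise `Q₁ ∕ Q₂` for (3.36).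
[cite: Balaban1985BackgroundPropagators, (3.35)–(3.36) p.396 («O(1) … a number ≧ 10»), Thm 3.1 p.397 («0 < α₀ ≦ α₁»)] -/
def extraYPb : RegExtraY d ℓ hd hL b₀ b₁ Mstar 𝔸 where
  P₁ := fun x _ α₀ U => 0 ≤ α₀ ∧ B9BackgroundsKLevelV1P.Reg335PC 𝔸 x.toKIdx (B9BackgroundsKLevelV1P.cubeClassP x.toKIdx c35Y)
    ((B6KLevelCensusIndexV1.kGeo x.toKIdx).M * α₀) U
  P₂ := fun x _ α₀ U => (bg9KP 𝔸 G x.snd).Reg335 c35Y α₀ U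
  Q₁ := fun x _ α₀ U => 0 ≤ α₀ ∧ B9BackgroundsKLevelV1P.Reg336PC 𝔸 x.toKIdx (B9BackgroundsKLevelV1P.cubeClassP x.toKIdx c35Y)
    ((B6KLevelCensusIndexV1.kGeo x.toKIdx).M * α₀) U
  Q₂ := fun x _ α₀ U => (bg9KP 𝔸 G x.snd).Reg336 c35Y α₀ U

variable {𝔸 G}

/-- the parametric (3.35) family at the record's reading IS `regYPb335` up to the order of conjuncts: one direction, at every pair of thresholds.
[cite: Balaban1985BackgroundPropagators, (3.35) p.396 (bookkeeping)] -/
theorem classIncl_regC335Pb_regYPb335 (c c' : ℝ) :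
    ClassIncl (regC335 𝔸 G (extraYPb (d := d) (ℓ := ℓ) (hd := hd) (hL := hL) (b₀ := b₀) (b₁ := b₁) (Mstar := Mstar) 𝔸 G)) c (regYPb335 𝔸 G) c' :=
  fun _ _ _ _ h => ⟨h.1.2.1, ⟨h.1.1, h.1.2.2⟩, h.2⟩

/-- … and the other direction. [cite: Balaban1985BackgroundPropagators, (3.35) p.396 (bookkeeping)] -/
theorem classIncl_regYPb335_regC335Pb (c c' : ℝ) :
    ClassIncl (regYPb335 𝔸 G) c (regC335 𝔸 G (extraYPb (d := d) (ℓ := ℓ) (hd := hd) (hL := hL) (b₀ := b₀) (b₁ := b₁) (Mstar := Mstar) 𝔸 G)) c' :=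
  fun _ _ _ _ h => ⟨⟨h.2.1.1, h.1, h.2.1.2⟩, h.2.2⟩

/-- the parametric (3.36) family at the record's reading IS `regYPb336` up to the order of conjuncts: one direction.
[cite: Balaban1985BackgroundPropagators, (3.36) p.396 (bookkeeping)] -/
theorem classIncl_regC336Pb_regYPb336 (c c' : ℝ) :
    ClassIncl (regC336 𝔸 G (extraYPb (d := d) (ℓ := ℓ) (hd := hd) (hL := hL) (b₀ := b₀) (b₁ := b₁) (Mstar := Mstar) 𝔸 G)) c (regYPb336 𝔸 G) c' :=
  fun _ _ _ _ h => ⟨h.1.2.1, ⟨h.1.1, h.1.2.2⟩, h.2⟩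

/-- … and the other direction. [cite: Balaban1985BackgroundPropagators, (3.36) p.396 (bookkeeping)] -/
theorem classIncl_regYPb336_regC336Pb (c c' : ℝ) :
    ClassIncl (regYPb336 𝔸 G) c (regC336 𝔸 G (extraYPb (d := d) (ℓ := ℓ) (hd := hd) (hL := hL) (b₀ := b₀) (b₁ := b₁) (Mstar := Mstar) 𝔸 G)) c' :=
  fun _ _ _ _ h => ⟨⟨h.2.1.1, h.1, h.2.1.2⟩, h.2.2⟩

end Literature.MathematicalPhysics.QuantumFieldTheory.Balaban1983to89.B9SectBCodedClassR

end
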